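import Literature.NumberTheory.GelbartRogawski1991.Prop311AdelicCoordinates
import Literature.NumberTheory.GelbartRogawski1991.Prop311RationalSplittingUnique
import Literature.RepresentationTheory.HeisenbergGroup.HeisenbergPairUniqueness
import Literature.RepresentationTheory.HeisenbergGroup.HeisenbergTwoFactors
import Literature.NumberTheory.Automorphic.AdeleAddCharArchimedeanLinearForm
import Literature.NumberTheory.Automorphic.AdeleAddCharProductFormula
import Literature.NumberTheory.Automorphic.FiniteAdeleDualLatticePair
import HarnessLib

/-!
# [GelbartRogawski1991, §3.1 p. 454 L20–21]: "`ρ_ψ` is unique up to isomorphism" — for the PRINTED `H_𝐀(W)`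

Topic `NumberTheory/GelbartRogawski1991`; namespace `Literature.NumberTheory.GelbartRogawski1991.Prop311` (the
namespace of the auxiliary objects of the statement-exact typing `Prop311AsPrinted`).  KERNEL ONLY: theorems; no
definition, no named fact, no `sorry`; `Prop311AsPrinted` itself is untouched (nothing of it is assumed or asserted).

[GelbartRogawski1991, §3.1 p. 454 L17–21] (verbatim): "*Let `(W, φ)` be a symplectic space over `F` and let
`H(W) = W ⊕ F` be the associated Heisenberg group. … For each non-trivial character `ψ`, let `ρ_ψ` be an
irreducible unitary representation of `H_𝐀(W)` with central character `ψ` (`ρ_ψ` is unique up to isomorphism).*"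

**`rho_unique`** proves the parenthetical claim for EXACTLY the objects of `Prop311AsPrinted` (renderings R6, R8):
`F` a number field, `E/F` quadratic with conjugation `σ`, `ψ` a continuous character of `𝐀 = AdeleRing (𝓞 F) F`
trivial on `F` with `ψ ≠ 1`, `(V, Φ)` skew-Hermitian with `φ = Tr_{E/F} Φ` non-degenerate, and two irreducible
unitary representations `ρ`, `ρ'` of `H_𝐀(W) = Prop311.AdelicHeisenberg F E V Φ` on Hilbert spaces `S, S' ≠ 0`
(isometric, continuous orbit maps for `heisenbergTopology`, no closed invariant subspaces other than `⊥, ⊤`,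
central character `ψ`): there is a unitary `U : S ≃ₗᵢ[ℂ] S'` with `U ρ(h) = ρ'(h) U` for all `h ∈ H_𝐀(W)`, and
any two such differ by a scalar of modulus `1`.

Proof = the tree's model-free uniqueness for the SHAPE `H(W_∞) · H(W_fin)`
(`HeisenbergGroup.exists_linearIsometryEquiv_of_irreducible_heisenberg_pair`, von Neumann / Stone–von Neumann at
the archimedean places glued with the lattice method at the finite adeles) applied in the adelic Darboux coordinates
of `Prop311AdelicCoordinates`: `H(W_∞) = Heisenberg (altPolar ·)` over `F_∞ ≅ ℝ^{r₁} × ℂ^{r₂}`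
(`InfiniteAdeleRing.ringEquiv_mixedSpace`) and `H(W_fin) = Heisenberg (polar ·)` over `𝐀_F^∞` embed by
`Heisenberg.map` (`HeisenbergCoboundary`, `HeisenbergTwoFactors`: they commute and generate), the archimedean
central character is `e ∘ ℓ` with `ℓ` non-degenerate (`AdeleAddCharArchimedeanLinearForm`, every `ψ_v ≠ 1`), the
finite one is `∏_v ψ_v` (`AdeleAddCharProductFormula`), and `((∏𝒪_v)ⁿ, (∏𝔠_{ψ_v})ⁿ)` is the dual lattice pair
(`FiniteAdeleDualLatticePair`, `ψ_v` unramified almost everywhere).  Irreducibility is used only through "no closed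
invariant subspace", exactly as rendered in `Prop311AsPrinted`; `S ≠ 0` (`[Nontrivial S]`) is the standing
meaning of "irreducible".

## References
* [GelbartRogawski1991] S. Gelbart, J. Rogawski, Invent. Math. 105 (1991), §3.1 p. 454 L17–27.
* [vonNeumann1931] J. von Neumann, *Die Eindeutigkeit der Schrödingerschen Operatoren*, Math. Ann. 104 (1931), §5.
* [Weil1964] A. Weil, Acta Math. 111 (1964), Chap. I n° 11–12, Chap. III n° 37–39.
-/

set_option autoImplicit false

noncomputable section

open NumberField IsDedekindDomain NumberField.mixedEmbedding InfiniteAdeleRing Filter Topology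
open Literature.RepresentationTheory.HeisenbergGroup Literature.NumberTheory.Automorphic
open Literature.RepresentationTheory.HeisenbergGroup.RestrictedPair
open scoped TensorProduct FourierTransform Pointwise RestrictedProduct

namespace Literature.NumberTheory.GelbartRogawski1991

namespace Prop311

/-! ## §1 Two algebraic helpers -/

/-- the standard alternating form `x · y' − x' · y` over a commutative ring in which `2` is a unit detects every
non-zero vector through its antisymmetrisation `2 (x · y' − x' · y)` (hypothesis `hs` of
`nondegenerate_realForm_sub_flip`). [cite: GelbartRogawski1991, §3.1 p. 454 L17–21] -/
theorem exists_altPolar_sub_altPolar_ne_zero {R : Type*} [CommRing R] {m : Type*} [Fintype m] [DecidableEq m]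
    (h2 : IsUnit (2 : R)) (x : (m → R) × (m → R)) (hx : x ≠ 0) :
    ∃ y : (m → R) × (m → R),
      altPolar (Matrix.toLinearMap₂' R (1 : Matrix m m R)) x y -
        altPolar (Matrix.toLinearMap₂' R (1 : Matrix m m R)) y x ≠ 0 := by
  by_cases h1 : x.1 = 0
  · have hx2 : x.2 ≠ 0 := fun h => hx (Prod.ext h1 h)
    obtain ⟨i, hi⟩ := Function.ne_iff.mp hx2
    refine ⟨(Pi.single i 1, 0), ?_⟩
    have h : altPolar (Matrix.toLinearMap₂' R (1 : Matrix m m R)) x (Pi.single i 1, 0) -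
        altPolar (Matrix.toLinearMap₂' R (1 : Matrix m m R)) (Pi.single i 1, 0) x = -(2 * x.2 i) := by
      simp only [altPolar_apply, Matrix.toLinearMap₂'_apply', Matrix.one_mulVec, h1, dotProduct_zero,
        single_dotProduct, one_mul]
      ring
    rw [h, Ne, neg_eq_zero, h2.mul_right_eq_zero]
    exact hi
  · obtain ⟨i, hi⟩ := Function.ne_iff.mp h1
    refine ⟨(0, Pi.single i 1), ?_⟩
    have h : altPolar (Matrix.toLinearMap₂' R (1 : Matrix m m R)) x (0, Pi.single i 1) -
        altPolar (Matrix.toLinearMap₂' R (1 : Matrix m m R)) (0, Pi.single i 1) x = 2 * x.1 i := by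
      simp only [altPolar_apply, Matrix.toLinearMap₂'_apply', Matrix.one_mulVec, zero_dotProduct,
        dotProduct_single, mul_one]
      ring
    rw [h, Ne, h2.mul_right_eq_zero]
    exact hi

/-- `2` is a unit of `ℝ^{r₁} × ℂ^{r₂}`. [cite: GelbartRogawski1991, §3.1 p. 454 L17–21] -/
theorem isUnit_two_mixedSpace (F : Type) [Field F] [NumberField F] : IsUnit (2 : mixedSpace F) := by
  have h := (isUnit_iff_ne_zero.mpr (two_ne_zero : (2 : ℝ) ≠ 0)).map (algebraMap ℝ (mixedSpace F))
  rwa [map_ofNat] at h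

/-! ## §2 The uniqueness of `ρ_ψ` -/

/-- **[GelbartRogawski1991, §3.1 p. 454 L20–21] "(`ρ_ψ` is unique up to isomorphism)"**, for the printed adelic
Heisenberg group `H_𝐀(W)` of `Prop311AsPrinted`: two irreducible unitary representations `ρ`, `ρ'` of
`H_𝐀(W) = Prop311.AdelicHeisenberg F E V Φ` with central character the non-trivial character `ψ` of `F\𝐀`, on
Hilbert spaces `S, S' ≠ 0` (isometric; continuous orbit maps for `heisenbergTopology`; no closed invariant subspace
other than `⊥`, `⊤`), are unitarily equivalent: `∃ U : S ≃ₗᵢ[ℂ] S'` with `U (ρ h f) = ρ' h (U f)`; and such a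
`U` is unique up to a scalar of modulus `1` (the kernel `ℂ*` of "`0 ⟶ ℂ* ⟶ Mp_𝐀(W) ⟶π Sp_𝐀(W) ⟶ 0`",
p. 454 L26–27). [cite: GelbartRogawski1991, §3.1 p. 454 L17–27] -/
theorem rho_unique (F : Type) [Field F] [NumberField F]
    (E : Type) [Field E] [Algebra F E] [Algebra.IsQuadraticExtension F E] (σ : E ≃ₐ[F] E)
    (ψ : AddChar (AdeleRing (𝓞 F) F) Circle) (hψc : Continuous ψ)
    (hψF : ∀ x : F, ψ (algebraMap F (AdeleRing (𝓞 F) F) x) = 1) (hψ1 : ψ ≠ 1)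
    (V : Type) [AddCommGroup V] [Module F V] [Module E V] [IsScalarTower F E V] [FiniteDimensional E V]
    (Φ : V →ₗ[F] V →ₗ[F] E) (hΦ₃ : ∀ x y : V, Φ y x = -σ (Φ x y)) (hφ : (traceForm F E V Φ).Nondegenerate)
    (S : Type) [NormedAddCommGroup S] [InnerProductSpace ℂ S] [CompleteSpace S] [Nontrivial S]
    (ρ : Representation ℂ (AdelicHeisenberg F E V Φ) S)
    (hρu : ∀ (h : AdelicHeisenberg F E V Φ) (f : S), ‖ρ h f‖ = ‖f‖)
    (hρc : ∀ f : S, @Continuous _ _ (heisenbergTopology F E V Φ) _ fun h => ρ h f)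
    (hρi : ∀ K : Submodule ℂ S, IsClosed (K : Set S) →
      (∀ (h : AdelicHeisenberg F E V Φ), ∀ f ∈ K, ρ h f ∈ K) → K = ⊥ ∨ K = ⊤)
    (hρz : ∀ (t : AdeleRing (𝓞 F) F) (f : S),
      ρ (Heisenberg.ofCenter (heisForm F E V Φ) (Multiplicative.ofAdd t)) f = ((ψ t : Circle) : ℂ) • f)
    (S' : Type) [NormedAddCommGroup S'] [InnerProductSpace ℂ S'] [CompleteSpace S'] [Nontrivial S']
    (ρ' : Representation ℂ (AdelicHeisenberg F E V Φ) S')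
    (hρ'u : ∀ (h : AdelicHeisenberg F E V Φ) (f : S'), ‖ρ' h f‖ = ‖f‖)
    (hρ'c : ∀ f : S', @Continuous _ _ (heisenbergTopology F E V Φ) _ fun h => ρ' h f)
    (hρ'i : ∀ K : Submodule ℂ S', IsClosed (K : Set S') →
      (∀ (h : AdelicHeisenberg F E V Φ), ∀ f ∈ K, ρ' h f ∈ K) → K = ⊥ ∨ K = ⊤)
    (hρ'z : ∀ (t : AdeleRing (𝓞 F) F) (f : S'),
      ρ' (Heisenberg.ofCenter (heisForm F E V Φ) (Multiplicative.ofAdd t)) f = ((ψ t : Circle) : ℂ) • f) :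
    ∃ U : S ≃ₗᵢ[ℂ] S', (∀ (h : AdelicHeisenberg F E V Φ) (f : S), U (ρ h f) = ρ' h (U f)) ∧
      ∀ U' : S ≃ₗᵢ[ℂ] S', (∀ (h : AdelicHeisenberg F E V Φ) (f : S), U' (ρ h f) = ρ' h (U' f)) →
        ∃ c : ℂ, ‖c‖ = 1 ∧ ∀ f : S, U' f = c • U f := by
  classical
  haveI : FiniteDimensional F V := finite_restrictScalars F E V
  letI i2f : Invertible (2 : FiniteAdeleRing (𝓞 F) F) :=
    ((invertibleOfNonzero (two_ne_zero' F)).map (algebraMap F (FiniteAdeleRing (𝓞 F) F))).copy _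
      (map_ofNat (algebraMap F (FiniteAdeleRing (𝓞 F) F)) 2).symm
  haveI : Fact (∀ v : HeightOneSpectrum (𝓞 F), IsOpen (v.adicCompletionIntegers F : Set (v.adicCompletion F))) :=
    ⟨fun _ => Valued.isOpen_valuationSubring _⟩
  have hψ : IsGlobalAddChar F ψ := ⟨hψc, hψF, hψ1⟩
  -- adelic Darboux coordinates and the archimedean linear form of `ψ`
  obtain ⟨n, e, he⟩ := exists_adelicDarboux F E V Φ (isAlt_traceForm F E V Φ σ hΦ₃) hφ
  obtain ⟨ℓ, hℓψ, hℓnd, hℓsurj⟩ := hψ.exists_linearMap_fourierChar_eq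
  -- topologies of record
  letI tW : TopologicalSpace (AdelicSpace F V) := adelicSpaceTopology F V
  letI tH : TopologicalSpace (AdelicHeisenberg F E V Φ) := heisenbergTopology F E V Φ
  /- the archimedean factor `H(W_∞) = Heisenberg (altPolar βM)` over `M = ℝ^{r₁} × ℂ^{r₂}` -/
  set βM : (Fin n → mixedSpace F) →ₗ[mixedSpace F] (Fin n → mixedSpace F) →ₗ[mixedSpace F] mixedSpace F :=
    Matrix.toLinearMap₂' (mixedSpace F) (1 : Matrix (Fin n) (Fin n) (mixedSpace F)) with hβM
  set J₁ : (Fin n → mixedSpace F) × (Fin n → mixedSpace F) →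
      (Fin n → AdeleRing (𝓞 F) F) × (Fin n → AdeleRing (𝓞 F) F) :=
    fun v => (fun i => 2 * infiniteAdeleInl F ((ringEquiv_mixedSpace F).symm (v.1 i)),
      fun i => infiniteAdeleInl F ((ringEquiv_mixedSpace F).symm (v.2 i))) with hJ₁
  have hJ₁add : ∀ a b, J₁ (a + b) = J₁ a + J₁ b := fun a b => by
    refine Prod.ext (funext fun i => ?_) (funext fun i => ?_)
    · change 2 * infiniteAdeleInl F ((ringEquiv_mixedSpace F).symm (a.1 i + b.1 i)) =
        2 * infiniteAdeleInl F ((ringEquiv_mixedSpace F).symm (a.1 i)) +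
          2 * infiniteAdeleInl F ((ringEquiv_mixedSpace F).symm (b.1 i))
      rw [map_add, map_add, mul_add]
    · change infiniteAdeleInl F ((ringEquiv_mixedSpace F).symm (a.2 i + b.2 i)) =
        infiniteAdeleInl F ((ringEquiv_mixedSpace F).symm (a.2 i)) +
          infiniteAdeleInl F ((ringEquiv_mixedSpace F).symm (b.2 i))
      rw [map_add, map_add]
  let j₁ : (Fin n → mixedSpace F) × (Fin n → mixedSpace F) →+ AdelicSpace F V :=
    AddMonoidHom.mk' (fun v => e (J₁ v)) fun a b => by
      change e (J₁ (a + b)) = e (J₁ a) + e (J₁ b)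
      rw [hJ₁add, map_add]
  let k₁ : mixedSpace F →+ AdeleRing (𝓞 F) F :=
    (infiniteAdeleInl F : InfiniteAdeleRing F →ₙ+* AdeleRing (𝓞 F) F).toAddMonoidHom.comp
      (ringEquiv_mixedSpace F).symm.toAddMonoidHom
  have hk₁ : ∀ t, k₁ t = infiniteAdeleInl F ((ringEquiv_mixedSpace F).symm t) := fun t => rfl
  have hjk₁ : ∀ v w, heisForm F E V Φ (j₁ v) (j₁ w) = k₁ (altPolar βM v w) := fun v w =>
    heisForm_coord_arch he v w
  let ι₁ : Heisenberg (altPolar βM) →* AdelicHeisenberg F E V Φ := Heisenberg.map (heisForm F E V Φ) j₁ k₁ hjk₁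
  /- the finite-adelic factor `H(W_fin) = Heisenberg (polar βf)` over `𝐀_F^∞` -/
  set βf : (Fin n → FiniteAdeleRing (𝓞 F) F) →ₗ[FiniteAdeleRing (𝓞 F) F]
      (Fin n → FiniteAdeleRing (𝓞 F) F) →ₗ[FiniteAdeleRing (𝓞 F) F] FiniteAdeleRing (𝓞 F) F :=
    Matrix.toLinearMap₂' (FiniteAdeleRing (𝓞 F) F) (1 : Matrix (Fin n) (Fin n) (FiniteAdeleRing (𝓞 F) F)) with hβf
  set J₂ : (Fin n → FiniteAdeleRing (𝓞 F) F) × (Fin n → FiniteAdeleRing (𝓞 F) F) →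
      (Fin n → AdeleRing (𝓞 F) F) × (Fin n → AdeleRing (𝓞 F) F) :=
    fun w => (fun i => finiteAdeleInr F (w.1 i), fun i => finiteAdeleInr F (w.2 i)) with hJ₂
  have hJ₂add : ∀ a b, J₂ (a + b) = J₂ a + J₂ b := fun a b => by
    refine Prod.ext (funext fun i => ?_) (funext fun i => ?_)
    · exact map_add (finiteAdeleInr F) (a.1 i) (b.1 i)
    · exact map_add (finiteAdeleInr F) (a.2 i) (b.2 i)
  let j₂ : (Fin n → FiniteAdeleRing (𝓞 F) F) × (Fin n → FiniteAdeleRing (𝓞 F) F) →+ AdelicSpace F V :=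
    AddMonoidHom.mk' (fun w => e (J₂ w)) fun a b => by
      change e (J₂ (a + b)) = e (J₂ a) + e (J₂ b)
      rw [hJ₂add, map_add]
  let k₂ : FiniteAdeleRing (𝓞 F) F →+ AdeleRing (𝓞 F) F :=
    (finiteAdeleInr F : FiniteAdeleRing (𝓞 F) F →ₙ+* AdeleRing (𝓞 F) F).toAddMonoidHom
  have hk₂ : ∀ t, k₂ t = finiteAdeleInr F t := fun t => rfl
  have hjk₂ : ∀ v w, heisForm F E V Φ (j₂ v) (j₂ w) = k₂ (((⅟(2 : FiniteAdeleRing (𝓞 F) F)) • altPolar βf) v w) :=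
    fun v w => heisForm_coord_fin he v w
  let ι₂' : Heisenberg ((⅟(2 : FiniteAdeleRing (𝓞 F) F)) • altPolar βf) →* AdelicHeisenberg F E V Φ :=
    Heisenberg.map (heisForm F E V Φ) j₂ k₂ hjk₂
  let ι₂ : Heisenberg (polar βf) →* AdelicHeisenberg F E V Φ := ι₂'.comp (halfAltPolarEquiv βf).symm.toMonoidHom
  have hι₂ : ∀ h, ι₂ h = ι₂' ((halfAltPolarEquiv βf).symm h) := fun h => rfl
  /- the two factors commute and generate -/
  have h₁₂ : ∀ v w, heisForm F E V Φ (j₁ v) (j₂ w) = 0 := fun v w => heisForm_coord_arch_fin he v w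
  have h₂₁ : ∀ v w, heisForm F E V Φ (j₂ w) (j₁ v) = 0 := fun v w => heisForm_coord_fin_arch he v w
  have hV : ∀ x : AdelicSpace F V, ∃ v w, x = j₁ v + j₂ w := fun x => by
    obtain ⟨v, w, hvw⟩ := exists_eq_archCoord_add_finCoord (F := F) (e.symm x)
    refine ⟨v, w, ?_⟩
    change x = e (J₁ v) + e (J₂ w)
    rw [← map_add, ← hvw, LinearEquiv.apply_symm_apply]
  have hR : ∀ t : AdeleRing (𝓞 F) F, ∃ t₁ t₂, t = k₁ t₁ + k₂ t₂ := fun t => exists_eq_inl_add_inr t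
  have hcomm : ∀ (h : Heisenberg (altPolar βM)) (h' : Heisenberg (polar βf)), ι₁ h * ι₂ h' = ι₂ h' * ι₁ h :=
    fun h h' => Heisenberg.map_mul_map_comm (heisForm F E V Φ) (altPolar βM)
      ((⅟(2 : FiniteAdeleRing (𝓞 F) F)) • altPolar βf) hjk₁ hjk₂ h₁₂ (fun v w => h₂₁ v w) h
      ((halfAltPolarEquiv βf).symm h')
  have hgen : ∀ g : AdelicHeisenberg F E V Φ, ∃ (h : Heisenberg (altPolar βM)) (h' : Heisenberg (polar βf)),
      g = ι₁ h * ι₂ h' := fun g => by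
    obtain ⟨h, h', hg⟩ := Heisenberg.exists_eq_map_mul_map (heisForm F E V Φ) (altPolar βM)
      ((⅟(2 : FiniteAdeleRing (𝓞 F) F)) • altPolar βf) hjk₁ hjk₂ h₁₂ hV hR g
    refine ⟨h, halfAltPolarEquiv βf h', ?_⟩
    rw [hg, hι₂, MulEquiv.symm_apply_apply]
  /- the finite-adelic dual lattice pair `((∏𝒪_v)ⁿ, (∏𝔠_{ψ_v})ⁿ)`, read on `FiniteAdeleRing (𝓞 F) F = Πʳ_v [F_v, 𝒪_v]` -/
  let ψf : AddChar (FiniteAdeleRing (𝓞 F) F) Circle :=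
    prodChar (A := fun v : HeightOneSpectrum (𝓞 F) => v.adicCompletionIntegers F) (fun v => ψ.adicComponent v)
      (eventually_forall_adicComponent_apply_eq_one hψ.continuous)
  have hψf : ∀ t, ψf t = prodChar (A := fun v : HeightOneSpectrum (𝓞 F) => v.adicCompletionIntegers F)
      (fun v => ψ.adicComponent v) (eventually_forall_adicComponent_apply_eq_one hψ.continuous) t := fun t => rfl
  let L₁ : AddSubgroup (Fin n → FiniteAdeleRing (𝓞 F) F) :=
    AddSubgroup.pi Set.univ fun _ : Fin n =>
      (box (A := fun v : HeightOneSpectrum (𝓞 F) => v.adicCompletionIntegers F) fun v =>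
        (IsUltrametricDist.closedBall_openAddSubgroup (v.adicCompletion F) one_pos).toAddSubgroup)
  let L₂ : AddSubgroup (Fin n → FiniteAdeleRing (𝓞 F) F) :=
    AddSubgroup.pi Set.univ fun _ : Fin n =>
      (box (A := fun v : HeightOneSpectrum (𝓞 F) => v.adicCompletionIntegers F) fun v =>
        mulDual (ψ.adicComponent v))
  have hL : IsDualLatticePair βf ψf L₁ L₂ := isDualLatticePair_finiteAdele_integers_conductor_pi hψ
  have hX : ∀ N ∈ 𝓝 (0 : Fin n → FiniteAdeleRing (𝓞 F) F), ∃ a : (FiniteAdeleRing (𝓞 F) F)ˣ,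
      (((a : FiniteAdeleRing (𝓞 F) F) • L₁ : AddSubgroup (Fin n → FiniteAdeleRing (𝓞 F) F)) :
        Set (Fin n → FiniteAdeleRing (𝓞 F) F)) ⊆ N :=
    fun N hN => exists_units_smul_finiteAdele_integers_pi_subset N hN
  have hY : ∀ N ∈ 𝓝 (0 : Fin n → FiniteAdeleRing (𝓞 F) F), ∃ a : (FiniteAdeleRing (𝓞 F) F)ˣ,
      (((a : FiniteAdeleRing (𝓞 F) F) • L₂ : AddSubgroup (Fin n → FiniteAdeleRing (𝓞 F) F)) :
        Set (Fin n → FiniteAdeleRing (𝓞 F) F)) ⊆ N :=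
    fun N hN => exists_units_smul_finiteAdele_conductor_pi_subset hψ N hN
  /- the characters: `ψ_∞ = e ∘ ℓ`, `ψ_f = ∏ ψ_v` -/
  have hψ₁ : ∀ t : mixedSpace F, ψ (k₁ t) = 𝐞 (ℓ t) := fun t => by
    rw [hk₁, hℓψ, RingEquiv.apply_symm_apply]
  have hψ₂ : ∀ t : FiniteAdeleRing (𝓞 F) F, ψ (k₂ t) = ψf t := fun t => by
    rw [hk₂, finiteAdeleInr_apply, map_zero_prod_eq_finprod_adicComponent hψc, hψf, prodChar_apply]
    rfl
  -- non-degeneracy of the archimedean commutator form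
  have hs : (realForm (altPolar βM) ℓ - (realForm (altPolar βM) ℓ).flip).Nondegenerate :=
    nondegenerate_realForm_sub_flip (altPolar βM) ℓ hℓnd fun x hx =>
      exists_altPolar_sub_altPolar_ne_zero (isUnit_two_mixedSpace F) x hx
  /- the hypotheses of the pair-uniqueness theorem, for a model `(T, θ)` -/
  have key : ∀ (T : Type) [NormedAddCommGroup T] [InnerProductSpace ℂ T]
      (θ : Representation ℂ (AdelicHeisenberg F E V Φ) T)
      (hθu : ∀ (h : AdelicHeisenberg F E V Φ) (f : T), ‖θ h f‖ = ‖f‖)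
      (hθc : ∀ f : T, Continuous fun h => θ h f)
      (hθi : ∀ K : Submodule ℂ T, IsClosed (K : Set T) →
        (∀ (h : AdelicHeisenberg F E V Φ), ∀ f ∈ K, θ h f ∈ K) → K = ⊥ ∨ K = ⊤)
      (hθz : ∀ (t : AdeleRing (𝓞 F) F) (f : T),
        θ (Heisenberg.ofCenter (heisForm F E V Φ) (Multiplicative.ofAdd t)) f = ((ψ t : Circle) : ℂ) • f),
      (∀ (h : Heisenberg (altPolar βM)) (f : T), ‖(θ.comp ι₁) h f‖ = ‖f‖) ∧
      (∀ f : T, Continuous fun y : (Fin n → mixedSpace F) × (Fin n → mixedSpace F) => (θ.comp ι₁) ⟨y, 0⟩ f) ∧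
      (∀ (t : mixedSpace F) (f : T), (θ.comp ι₁) (Heisenberg.ofCenter (altPolar βM) (Multiplicative.ofAdd t)) f =
        ((𝐞 (ℓ t) : Circle) : ℂ) • f) ∧
      (∀ (h : Heisenberg (polar βf)) (f : T), ‖(θ.comp ι₂) h f‖ = ‖f‖) ∧
      (∀ f : T, Continuous fun w : (Fin n → FiniteAdeleRing (𝓞 F) F) × (Fin n → FiniteAdeleRing (𝓞 F) F) =>
        (θ.comp ι₂) ⟨w, 0⟩ f) ∧
      (∀ (t : FiniteAdeleRing (𝓞 F) F) (f : T),
        (θ.comp ι₂) (Heisenberg.ofCenter (polar βf) (Multiplicative.ofAdd t)) f =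
          ((ψf t : Circle) : ℂ) • f) ∧
      (∀ (h : Heisenberg (altPolar βM)) (h' : Heisenberg (polar βf)) (f : T),
        (θ.comp ι₁) h ((θ.comp ι₂) h' f) = (θ.comp ι₂) h' ((θ.comp ι₁) h f)) ∧
      (∀ K : Submodule ℂ T, IsClosed (K : Set T) → (∀ (h : Heisenberg (altPolar βM)), ∀ f ∈ K, (θ.comp ι₁) h f ∈ K) →
        (∀ (h' : Heisenberg (polar βf)), ∀ f ∈ K, (θ.comp ι₂) h' f ∈ K) → K = ⊥ ∨ K = ⊤) := by
    intro T _ _ θ hθu hθc hθi hθz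
    refine ⟨fun h f => hθu _ f, fun f => ?_, fun t f => ?_, fun h f => hθu _ f, fun f => ?_, fun t f => ?_,
      fun h h' f => ?_, fun K hKc hK₁ hK₂ => ?_⟩
    · -- continuity of the archimedean orbit maps
      have h1 : Continuous fun y : (Fin n → mixedSpace F) × (Fin n → mixedSpace F) =>
          (ι₁ ⟨y, 0⟩ : AdelicHeisenberg F E V Φ) := by
        change Continuous fun y : (Fin n → mixedSpace F) × (Fin n → mixedSpace F) =>
          (⟨j₁ y, k₁ 0⟩ : AdelicHeisenberg F E V Φ)
        exact continuous_heisenberg_mk (heisForm F E V Φ) (adelicSpaceTopology F V) inferInstance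
          ((continuous_coord (e := e)).comp continuous_archCoord) continuous_const
      exact (hθc f).comp h1
    · -- the archimedean central character
      change θ (ι₁ (Heisenberg.ofCenter (altPolar βM) (Multiplicative.ofAdd t))) f = _
      rw [Heisenberg.map_ofCenter hjk₁, hθz, hψ₁]
    · -- continuity of the finite-adelic orbit maps
      have hmk : ∀ w : (Fin n → FiniteAdeleRing (𝓞 F) F) × (Fin n → FiniteAdeleRing (𝓞 F) F),
          ι₂ ⟨w, 0⟩ = (⟨j₂ w, k₂ (0 - ⅟(2 : FiniteAdeleRing (𝓞 F) F) * (w.1 ⬝ᵥ w.2))⟩ :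
            AdelicHeisenberg F E V Φ) := fun w => by
        rw [hι₂]
        apply Heisenberg.ext
        · rfl
        · change k₂ (((halfAltPolarEquiv βf).symm ⟨w, 0⟩).t) = k₂ (0 - ⅟(2 : FiniteAdeleRing (𝓞 F) F) * (w.1 ⬝ᵥ w.2))
          rw [halfAltPolarEquiv, Heisenberg.coboundaryEquiv_symm_apply_t, hβf, Matrix.toLinearMap₂'_apply',
            Matrix.one_mulVec]
      have h1 : Continuous fun w : (Fin n → FiniteAdeleRing (𝓞 F) F) × (Fin n → FiniteAdeleRing (𝓞 F) F) =>
          (ι₂ ⟨w, 0⟩ : AdelicHeisenberg F E V Φ) := by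
        simp_rw [hmk]
        exact continuous_heisenberg_mk (heisForm F E V Φ) (adelicSpaceTopology F V) inferInstance
          ((continuous_coord (e := e)).comp continuous_finCoord)
          ((continuous_finiteAdeleInr F).comp (continuous_const.sub (continuous_const.mul
            ((continuous_fst).dotProduct continuous_snd))))
      exact (hθc f).comp h1
    · -- the finite-adelic central character
      change θ (ι₂' ((halfAltPolarEquiv βf).symm (Heisenberg.ofCenter (polar βf) (Multiplicative.ofAdd t)))) f = _
      rw [show (halfAltPolarEquiv βf).symm (Heisenberg.ofCenter (polar βf) (Multiplicative.ofAdd t)) =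
          Heisenberg.ofCenter _ (Multiplicative.ofAdd t) from by
            rw [MulEquiv.symm_apply_eq]
            exact (halfAltPolarEquiv_ofCenter βf _).symm,
        Heisenberg.map_ofCenter hjk₂, hθz, hψ₂]
    · -- the two factors commute
      change θ (ι₁ h) (θ (ι₂ h') f) = θ (ι₂ h') (θ (ι₁ h) f)
      rw [← Module.End.mul_apply, ← map_mul, hcomm, map_mul, Module.End.mul_apply]
    · -- joint irreducibility
      exact jointly_irreducible_of_generated ι₁ ι₂ θ hgen hθi K hKc hK₁ hK₂
  obtain ⟨h₁u, h₁c, h₁z, h₁τu, h₁τc, h₁τz, h₁co, h₁i⟩ := key S ρ hρu hρc hρi hρz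
  obtain ⟨h₂u, h₂c, h₂z, h₂τu, h₂τc, h₂τz, h₂co, h₂i⟩ := key S' ρ' hρ'u hρ'c hρ'i hρ'z
  obtain ⟨U, hU₁, hU₂⟩ := exists_linearIsometryEquiv_of_irreducible_heisenberg_pair (altPolar βM) ℓ βf ψf
    hℓsurj hs hL hX hY (ρ.comp ι₁) (ρ'.comp ι₁) (ρ.comp ι₂) (ρ'.comp ι₂) h₁u h₂u h₁c h₂c h₁z h₂z h₁τu h₂τu h₁τc h₂τc h₁τz h₂τz
    h₁co h₂co h₁i h₂i
  refine ⟨U, fun h f => intertwines_of_generated ι₁ ι₂ ρ hgen ρ' U hU₁ hU₂ h f, fun U' hU' => ?_⟩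
  exact linearIsometryEquiv_unique_of_heisenberg_pair (altPolar βM) ℓ βf ψf hℓsurj hs hL hX hY (ρ.comp ι₁)
    (ρ'.comp ι₁) (ρ.comp ι₂) (ρ'.comp ι₂) h₁u h₁c h₁z h₁τu h₁τc h₁τz h₁co h₁i U U' hU₁ hU₂
    (fun h f => hU' (ι₁ h) f) (fun h' f => hU' (ι₂ h') f)

end Prop311

end Literature.NumberTheory.GelbartRogawski1991

end
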